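import Summits.QuantumFields.BalabanUV.Beta.RemainderExplicitHistoryDiagonalEchoMonotone

/-!
# RemainderExplicitHistoryDiagonalMemoryZoneBackward — ROAD P3, ORDER-0 PROFILE FAMILY: THE BACKWARD MEMORY-ZONE CRITERION AND THE MIXED SCHEME —
# for two infrared-pinned runs of `β_{k+1} = b + Σ_{a≤k} ρ(a)·min(g_k, |g_k − g_{k−a}|)` with a non-increasing profile: if the matched discrepancy
# `d` is non-increasing on `[j+1, K]` (backward hypothesis) then `d_{j+1} ≤ d_j` as soon as the BACKWARD CRITERION
# `R_j((g^A_j)³∕2)·U_{j+1} ≤ (1 − Γ_j)E_j + (1 − Γ_j − Wγ∕(2b))S°_j` holds (`U_{j+1}` B's extra sources ahead, `Γ_j = Σ_{i≥j}((g^A_i)³∕2)R_{K−1−i} < 1`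
# the subcritical feedback of the gaps ahead — both explicit in the couplings and the profile); downward induction from the pin over the LATE memory
# zone; MIXED SCHEME: forward criterion (third ∕ fifth files) on `[1, J]` + backward criterion on `(J, A)` + the first file's echo count on `[A, K)`
# ⇒ census (i′) at every position (seat numerics: with the crude provable forms of both criteria such a `J` exists in 3 008∕3 008 cases at `Wγ ≤ b∕2`,
# 3 006∕3 008 at `0.9b`) (station S-d4p3-g54-1 «the echo count», sixth file)

Cell `pub-balaban`, β-function sub-cell, BINDER row D4 «RemainderConst leaves for Bałaban's split» (`HOME/BINDER-OWNERS.md`; owner lineage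
`b2b-balaban-beta-an4`; this file by co-owner #3 lineage `b2b-balaban-beta-d4-p3`, road P3 «the reduction road», generation 54, station
S-d4p3-g54-1, sixth file; imports the first file `RemainderExplicitHistoryDiagonalEchoMonotone` only), β-FLOW TEAM duty (1); FREEZE (0) honoured
(def-free module in road P3's own `RemainderExplicit*` series; no leaf, no interface, no Literature file).  SOURCE OF THE SHAPES ONLY:
[Balaban1987RG1] (0.20) p. 256, (0.31) and Thm 2 p. 259, §5 p. 298.  [folklore] real analysis about ONE explicit toy family (ours), road P3's
ORDER-0 PROFILE FAMILY (generation 44).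
HONEST FRAMING: *"Discharging BetaPertH makes Bałaban's UV stability UNCONDITIONAL — a real constructive-QFT result; it is NOT the continuum
limit and NOT the Clay problem."*  THIS FILE DISCHARGES NOTHING OF THE KIND; nothing of Bałaban's (1.22) is asserted or constructed; row D4
class UNCHANGED (critical-path width 0; instance 0∕1; D4 DISCHARGE NO DATE); NOT B12 Thm 2, NOT BetaPertH, NOT continuum, NOT Clay.  HONEST
DEPENDENCY: continuum YM on T⁴ ⇐ BetaPertH ∧ nine spine estimates (0/9 proved); BetaPertH ⇐ (D1) ∧ (D4) ∧ CAP+tail; G-an2-4 gates asym, D1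
and NE2/3/4.  ABSOLUTE RULE: nothing is cited as a fact.  All letters NOT-IN-PRINT; `BetaFlowAsPrinted S` records a Markov β_n only.

THE BACKWARD STEP (analysis `HOME/b2b-balaban-beta-d4-p3/g54/I-PRIME-ANALYSIS-v2.md` §2d–§2e).  If `d` is non-increasing on `[j+1, K]` but `d_j < d_{j+1}`,
then every gap from `j` on satisfies `e_i ≤ ((g^A_i)³∕2)d_{j+1}` (generation 49's `gap_le_cube_mul`); telescoping from the pin, `d_{j+1} = Σ_{l>j}(d_l − d_{l+1})
≤ Σ_{l>j}(E_l + S°_l)` and, for a NON-INCREASING profile, a later window sum exceeds the current one only through the new gaps,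
`S°_l ≤ S°_j + Σ_{i∈[j,l)} ρ(l−i)e_i` (`windowSum_later_le`); hence `d_{j+1}(1 − Γ_j) ≤ U_{j+1} + (K−1−j)S°_j` (`disc_succ_mul_le_of_monotone_future`).
With `e_j < ((g^A_j)³∕2)d_{j+1}` and the ultraviolet suppression `R_j(g^A_j)³(K−1−j)∕2 ≤ Wγ∕(2b)` (first file) the step identity
`d_j − d_{j+1} = E_j + S°_j − R_je_j < 0` contradicts the criterion — so `d_{j+1} ≤ d_j` (`disc_succ_le_disc_of_backward_criterion`).  This is the natural
tool in the LATE memory zone (few sources ahead, `R_j(g^A_j)³(K−j) ≤ Wγ∕b`), complementary to the FORWARD criterion of the third ∕ fifth files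
(natural EARLY, where `β^A_j − b` is small).

WHAT IS PROVED ([folklore]; 0 sorry; 0 `def`).  §1 `windowSum_later_le`.  §2 **`disc_succ_mul_le_of_monotone_future`** (`d_{j+1}(1 − Γ_j) ≤ U_{j+1} +
(K−1−j)S°_j` under a monotone future).  §3 **`disc_succ_le_disc_of_backward_criterion`** (the backward step), **`disc_succ_le_disc_backward_zone`**
(criterion + `Γ_j < 1` on `(J, A)` ⇒ `d_{j+1} ≤ d_j` for all `j > J`, the stretch by the first file), **`disc_succ_le_disc_mixed`** (plus monotone on
`[0, J+1]` given ⇒ monotone at every `j < K`).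
-/

noncomputable section

open Finset Filter Topology

namespace Summit.QuantumFields.BalabanUV.Beta.RemainderExplicitHistoryDiagonalMemoryZoneBackward

open Literature.MathematicalPhysics.QuantumFieldTheory.Balaban1983to89
open Literature.MathematicalPhysics.QuantumFieldTheory.Balaban1983to89.FlowStep
open Literature.MathematicalPhysics.QuantumFieldTheory.Balaban1983to89.T4CouplingMatching
open Literature.MathematicalPhysics.QuantumFieldTheory.Balaban1983to89.T4ContinuumCoupling
open Summit.QuantumFields.BalabanUV.Beta.RemainderExplicitHistoryDiagonalMonotone
open Summit.QuantumFields.BalabanUV.Beta.RemainderExplicitHistoryDiagonalWeights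
open Summit.QuantumFields.BalabanUV.Beta.RemainderExplicitHistoryDiagonalTwoRun
open Summit.QuantumFields.BalabanUV.Beta.RemainderExplicitHistoryDiagonalWindow
open Summit.QuantumFields.BalabanUV.Beta.RemainderExplicitHistoryDiagonalOneStepMonotone
open Summit.QuantumFields.BalabanUV.Beta.RemainderExplicitHistoryDiagonalEchoMonotone

variable {β : HBeta} {b γ W : ℝ} {ρ : ℕ → ℝ}

/-! ## §1 Re-weighting a later window sum by the current one (non-increasing profile) -/

/-- **A LATER WINDOW SUM EXCEEDS THE CURRENT ONE ONLY THROUGH THE NEW GAPS.**  For a profile non-increasing on the positive ages, nonnegative gaps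
`e`, and positions `j < l`: `Σ_{i<l} ρ(l−i)e_i ≤ Σ_{i<j} ρ(j−i)e_i + Σ_{i∈[j,l)} ρ(l−i)e_i` — an old gap `e_i` (`i < j`) is seen from `l` with the older
age `l − i > j − i`, hence with a smaller weight. [folklore] -/
theorem windowSum_later_le (hmono : ∀ a, 1 ≤ a → ρ (a + 1) ≤ ρ a) {e : ℕ → ℝ} (he : ∀ i, 0 ≤ e i)
    {j l : ℕ} (hjl : j < l) :
    ∑ i ∈ range l, ρ (l - i) * e i ≤ (∑ i ∈ range j, ρ (j - i) * e i) + ∑ i ∈ Ico j l, ρ (l - i) * e i := by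
  rw [← Finset.sum_range_add_sum_Ico _ hjl.le]
  have h1 : ∑ i ∈ range j, ρ (l - i) * e i ≤ ∑ i ∈ range j, ρ (j - i) * e i := by
    refine Finset.sum_le_sum fun i hi => ?_
    have hi' := Finset.mem_range.mp hi
    exact mul_le_mul_of_nonneg_right (profile_le_of_le hmono (by omega) (by omega)) (he i)
  linarith

/-! ## §2 The backward step: under a monotone future, the discrepancy ahead is controlled by the sources ahead and the current window -/

/-- **THE DISCREPANCY AHEAD UNDER A MONOTONE FUTURE.**  Two runs of road P3's order-0 profile family (`b > 0`, `ρ ≥ 0` non-increasing on the positive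
ages; A: `K` steps, B: `K + n` steps, positive couplings, pinned) and a position `j < K` such that `d` is non-increasing on `[j+1, K]` AND
`d_j ≤ d_{j+1}` (the future dominates everything from `j` on).  THEN, with `S°_j = Σ_{i<j} ρ(j−i)e_i`, `U_{j+1} = Σ_{l∈(j,K)} E_l` and
`Γ_j = Σ_{i∈[j,K−1)} ((g^A_i)³∕2)·Σ_{a∈[1,K−1−i]} ρ(a)`:
`d_{j+1}·(1 − Γ_j) ≤ U_{j+1} + (K−1−j)·S°_j` — telescoping `d_{j+1} = Σ_{l>j} (d_l − d_{l+1})`, each decrement `≤ E_l + S°_l` (generation 49's step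
identity), `S°_l ≤ S°_j + (new gaps)` (`windowSum_later_le`) and every new gap `e_i ≤ ((g^A_i)³∕2)d_i ≤ ((g^A_i)³∕2)d_{j+1}` (`…Weights.gap_le_cube_mul`).
[cite: Balaban1987RG1, (0.20) p.256 and Thm 2 p.259] -/
theorem disc_succ_mul_le_of_monotone_future
    (hβ : ∀ (k : ℕ) (p : Fin (k + 1) → ℝ),
      β k p = b + ∑ i : Fin (k + 1), ρ (k - i) * min (p (Fin.last k)) (|p (Fin.last k) - p i|))
    (hb : 0 < b) (hρ0 : ∀ a, 0 ≤ ρ a) (hmono : ∀ a, 1 ≤ a → ρ (a + 1) ≤ ρ a) {K n : ℕ} {gA gB : ℕ → ℝ} (hA : RGEqH K β gA)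
    (hB : RGEqH (K + n) β gB) (hApos : ∀ k, k ≤ K → 0 < gA k) (hBpos : ∀ k, k ≤ K + n → 0 < gB k) (hpin : gA K = gB (K + n))
    {j : ℕ} (hj : j < K)
    (hfut : ∀ i, j ≤ i → i ≤ K → 1 / (gB (i + n)) ^ 2 - 1 / (gA i) ^ 2 ≤ 1 / (gB (j + 1 + n)) ^ 2 - 1 / (gA (j + 1)) ^ 2) :
    (1 / (gB (j + 1 + n)) ^ 2 - 1 / (gA (j + 1)) ^ 2)
        * (1 - ∑ i ∈ Ico j (K - 1), (gA i) ^ 3 / 2 * ∑ a ∈ Ico 1 (K - i), ρ a)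
      ≤ (∑ l ∈ Ico (j + 1) K, ∑ i ∈ range n, ρ (l + n - i) * (gB (l + n) - gB i))
        + ((K - 1 - j : ℕ) : ℝ) * ∑ i ∈ range j, ρ (j - i) * (gA i - gB (i + n)) := by
  have hdom := invSq_le_invSq_shift_run hβ hb hρ0 hA hB hApos hBpos hpin
  set d : ℕ → ℝ := fun i => 1 / (gB (i + n)) ^ 2 - 1 / (gA i) ^ 2 with hd
  set e : ℕ → ℝ := fun i => gA i - gB (i + n) with he_def
  have hd0 : ∀ i, i ≤ K → 0 ≤ d i := fun i hi => by simp only [hd]; linarith [hdom i hi]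
  have he0 : ∀ i, i ≤ K → 0 ≤ e i := fun i hi => by
    simp only [he_def]; linarith [le_of_one_div_sq_le (hApos i hi) (hBpos (i + n) (by omega)) (hdom i hi)]
  have he0' : ∀ i, 0 ≤ (if i ≤ K then e i else 0) := fun i => by split_ifs with h; exact he0 i h; exact le_rfl
  set D1 : ℝ := d (j + 1) with hD1
  set S0 : ℝ := ∑ i ∈ range j, ρ (j - i) * e i with hS0
  -- (1) telescoping from the pin: `d_{j+1} = Σ_{l∈[j+1,K)} (d_l − d_{l+1})`
  have hdK : d K = 0 := by simp [hd, hpin]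
  have htel : D1 = ∑ l ∈ Ico (j + 1) K, (d l - d (l + 1)) := by
    rw [Finset.sum_Ico_eq_sum_range]
    have h := Finset.sum_range_sub' (fun t => d (j + 1 + t)) (K - (j + 1))
    simp only [Nat.add_zero] at h
    rw [show j + 1 + (K - (j + 1)) = K by omega, hdK, sub_zero] at h
    rw [hD1, ← h]
    exact Finset.sum_congr rfl fun t _ => by rw [show j + 1 + (t + 1) = j + 1 + t + 1 by omega]
  -- (2) each decrement `≤ E_l + S°_l`, and `S°_l ≤ S°_j + Σ_{i∈[j,l)} ρ(l−i) e_i`, new gaps `≤ (g_i³/2) D1`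
  have hstep : ∀ l ∈ Ico (j + 1) K, d l - d (l + 1)
      ≤ (∑ i ∈ range n, ρ (l + n - i) * (gB (l + n) - gB i)) + (S0 + ∑ i ∈ Ico j l, ρ (l - i) * ((gA i) ^ 3 / 2 * D1)) := by
    intro l hl
    have hl' := Finset.mem_Ico.mp hl
    have hid := disc_step_window hβ hb hρ0 hA hB hApos hBpos hl'.2
    -- the feedback sum: Σ_{i≤l} ρ(l−i)(e_i − e_l) ≤ Σ_{i<l} ρ(l−i) e_i (drop the −R_l e_l ≤ 0 part and the i = l term)
    have hfb : ∑ i ∈ range (l + 1), ρ (l - i) * ((gA i - gB (i + n)) - (gA l - gB (l + n))) ≤ ∑ i ∈ range l, ρ (l - i) * e i := by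
      rw [Finset.sum_range_succ, Nat.sub_self, sub_self, mul_zero, add_zero]
      refine Finset.sum_le_sum fun i hi => ?_
      have hi' := Finset.mem_range.mp hi
      have := he0 l hl'.2.le
      simp only [he_def] at this ⊢
      nlinarith [hρ0 (l - i)]
    -- rewrite the `if`s away on the relevant ranges
    have hsw' : ∑ i ∈ range l, ρ (l - i) * e i ≤ S0 + ∑ i ∈ Ico j l, ρ (l - i) * e i := by
      have e1 : ∑ i ∈ range l, ρ (l - i) * (if i ≤ K then e i else 0) = ∑ i ∈ range l, ρ (l - i) * e i :=
        Finset.sum_congr rfl fun i hi => by rw [if_pos (by have := Finset.mem_range.mp hi; omega)]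
      have e2 : ∑ i ∈ range j, ρ (j - i) * (if i ≤ K then e i else 0) = S0 :=
        Finset.sum_congr rfl fun i hi => by rw [if_pos (by have := Finset.mem_range.mp hi; omega)]
      have e3 : ∑ i ∈ Ico j l, ρ (l - i) * (if i ≤ K then e i else 0) = ∑ i ∈ Ico j l, ρ (l - i) * e i :=
        Finset.sum_congr rfl fun i hi => by rw [if_pos (by have := (Finset.mem_Ico.mp hi).2; omega)]
      have h := windowSum_later_le hmono (e := fun i => if i ≤ K then e i else 0) he0' hl'.1
      rw [e1, e2, e3] at h; exact h
    have hnew : ∑ i ∈ Ico j l, ρ (l - i) * e i ≤ ∑ i ∈ Ico j l, ρ (l - i) * ((gA i) ^ 3 / 2 * D1) := by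
      refine Finset.sum_le_sum fun i hi => mul_le_mul_of_nonneg_left ?_ (hρ0 _)
      have hi' := Finset.mem_Ico.mp hi
      have hiK : i ≤ K := by omega
      have hcube := gap_le_cube_mul (hBpos (i + n) (by omega)) (le_of_one_div_sq_le (hApos i hiK) (hBpos (i + n) (by omega)) (hdom i hiK))
      have hdi : d i ≤ D1 := by simpa [hd, hD1] using hfut i hi'.1 hiK
      have hg3 : 0 ≤ (gA i) ^ 3 / 2 := div_nonneg (pow_nonneg (hApos i hiK).le 3) (by norm_num)
      calc e i ≤ (gA i) ^ 3 / 2 * d i := by simpa [he_def, hd] using hcube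
        _ ≤ (gA i) ^ 3 / 2 * D1 := mul_le_mul_of_nonneg_left hdi hg3
    have : d l - d (l + 1) = (∑ i ∈ range n, ρ (l + n - i) * (gB (l + n) - gB i))
        + ∑ i ∈ range (l + 1), ρ (l - i) * ((gA i - gB (i + n)) - (gA l - gB (l + n))) := by
      simpa [hd, Nat.add_right_comm l 1 n] using hid
    rw [this]
    linarith
  -- (3) sum over `l` and re-organise the double sum as `Γ_j · D1`
  have hsum := Finset.sum_le_sum hstep
  rw [← htel, Finset.sum_add_distrib, Finset.sum_add_distrib, Finset.sum_const, Nat.card_Ico, nsmul_eq_mul] at hsum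
  have hdouble : ∑ l ∈ Ico (j + 1) K, ∑ i ∈ Ico j l, ρ (l - i) * ((gA i) ^ 3 / 2 * D1)
      = D1 * ∑ i ∈ Ico j (K - 1), (gA i) ^ 3 / 2 * ∑ a ∈ Ico 1 (K - i), ρ a := by
    -- swap: pairs (l, i) with j+1 ≤ l < K, j ≤ i < l  ↔  j ≤ i < K−1, i+1 ≤ l < K; then a = l − i ∈ [1, K−i)
    rw [Finset.sum_sigma', Finset.mul_sum]
    rw [show (∑ i ∈ Ico j (K - 1), D1 * ((gA i) ^ 3 / 2 * ∑ a ∈ Ico 1 (K - i), ρ a))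
        = ∑ i ∈ Ico j (K - 1), ∑ l ∈ Ico (i + 1) K, ρ (l - i) * ((gA i) ^ 3 / 2 * D1) from ?_]
    · rw [Finset.sum_sigma']
      refine Finset.sum_nbij' (fun x => ⟨x.2, x.1⟩) (fun x => ⟨x.2, x.1⟩) ?_ ?_ (fun _ _ => rfl) (fun _ _ => rfl) (fun _ _ => rfl)
      · intro x hx
        simp only [Finset.mem_sigma, Finset.mem_Ico] at hx ⊢
        omega
      · intro x hx
        simp only [Finset.mem_sigma, Finset.mem_Ico] at hx ⊢
        omega
    · refine Finset.sum_congr rfl fun i hi => ?_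
      have hi' := Finset.mem_Ico.mp hi
      rw [Finset.mul_sum, Finset.mul_sum, Finset.sum_Ico_eq_sum_range, Finset.sum_Ico_eq_sum_range]
      rw [show K - (i + 1) = K - i - 1 by omega]
      refine Finset.sum_congr rfl fun t _ => ?_
      rw [show i + 1 + t - i = 1 + t by omega]; ring
  rw [hdouble] at hsum
  have hcast : (((K - (j + 1) : ℕ) : ℝ)) = ((K - 1 - j : ℕ) : ℝ) := by congr 1; omega
  rw [hcast] at hsum
  simp only [hS0, he_def] at hsum
  linarith

/-! ## §3 The backward criterion and the mixed scheme -/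

/-- **THE BACKWARD STEP.**  Two runs of road P3's order-0 profile family in ]0,γ] (`b > 0`, `ρ ≥ 0` non-increasing on the positive ages,
`Σ_{a<N} ρ(a) ≤ W`; A: `K` steps, B: `K + n` steps, pinned) and a position `j < K` with `d` non-increasing on `[j+1, K]` (the BACKWARD induction
hypothesis).  IF the BACKWARD CRITERION holds at `j`:
`R_j·((g^A_j)³∕2)·U_{j+1} ≤ (1 − Γ_j)·E_j + (1 − Γ_j − Wγ∕(2b))·S°_j` (`R_j = Σ_{a∈[1,j]} ρ(a)`, `U_{j+1} = Σ_{l∈(j,K)} E_l` B's extra sources ahead,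
`Γ_j = Σ_{i∈[j,K−1)} ((g^A_i)³∕2)Σ_{a∈[1,K−1−i]} ρ(a)`, `S°_j` the window sum), THEN `d_{j+1} ≤ d_j`.  PROOF: otherwise the future dominates everything from
`j` on, `disc_succ_mul_le_of_monotone_future` bounds `d_{j+1}`, `e_j ≤ ((g^A_j)³∕2)d_j < ((g^A_j)³∕2)d_{j+1}` and the ultraviolet suppression
`R_j(g^A_j)³(K−1−j)∕2 ≤ Wγ∕(2b)` (first file's `cube_mul_dist_le`) contradict the step identity `d_j − d_{j+1} = E_j + S°_j − R_je_j < 0`.  The natural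
tool in the LATE memory zone (few sources ahead); dropping `S°_j ≥ 0` leaves a criterion in the couplings and the profile alone.
[cite: Balaban1987RG1, (0.20) p.256, (0.31) and Thm 2 p.259] -/
theorem disc_succ_le_disc_of_backward_criterion
    (hβ : ∀ (k : ℕ) (p : Fin (k + 1) → ℝ),
      β k p = b + ∑ i : Fin (k + 1), ρ (k - i) * min (p (Fin.last k)) (|p (Fin.last k) - p i|))
    (hb : 0 < b) (hρ0 : ∀ a, 0 ≤ ρ a) (hρW : ∀ n, ∑ a ∈ range n, ρ a ≤ W) (hmono : ∀ a, 1 ≤ a → ρ (a + 1) ≤ ρ a)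
    {K n : ℕ} {gA gB : ℕ → ℝ} (hA : RGEqH K β gA) (hB : RGEqH (K + n) β gB) (hAbox : ∀ k, k ≤ K → 0 < gA k ∧ gA k ≤ γ)
    (hBpos : ∀ k, k ≤ K + n → 0 < gB k) (hpin : gA K = gB (K + n)) {j : ℕ} (hj : j < K)
    (hfut : ∀ l, j < l → l < K → 1 / (gB (l + 1 + n)) ^ 2 - 1 / (gA (l + 1)) ^ 2 ≤ 1 / (gB (l + n)) ^ 2 - 1 / (gA l) ^ 2)
    (hΓ : ∑ i ∈ Ico j (K - 1), (gA i) ^ 3 / 2 * ∑ a ∈ Ico 1 (K - i), ρ a < 1)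
    (hcrit : (∑ a ∈ Ico 1 (j + 1), ρ a) * ((gA j) ^ 3 / 2)
        * (∑ l ∈ Ico (j + 1) K, ∑ i ∈ range n, ρ (l + n - i) * (gB (l + n) - gB i))
      ≤ (1 - ∑ i ∈ Ico j (K - 1), (gA i) ^ 3 / 2 * ∑ a ∈ Ico 1 (K - i), ρ a)
          * (∑ i ∈ range n, ρ (j + n - i) * (gB (j + n) - gB i))
        + (1 - (∑ i ∈ Ico j (K - 1), (gA i) ^ 3 / 2 * ∑ a ∈ Ico 1 (K - i), ρ a) - W * γ / (2 * b))
          * ∑ i ∈ range j, ρ (j - i) * (gA i - gB (i + n))) :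
    1 / (gB (j + 1 + n)) ^ 2 - 1 / (gA (j + 1)) ^ 2 ≤ 1 / (gB (j + n)) ^ 2 - 1 / (gA j) ^ 2 := by
  have hApos : ∀ k, k ≤ K → 0 < gA k := fun k hk => (hAbox k hk).1
  have hdom := invSq_le_invSq_shift_run hβ hb hρ0 hA hB hApos hBpos hpin
  set d : ℕ → ℝ := fun i => 1 / (gB (i + n)) ^ 2 - 1 / (gA i) ^ 2 with hd
  -- names
  set Rj : ℝ := ∑ a ∈ Ico 1 (j + 1), ρ a with hRj
  set U1 : ℝ := ∑ l ∈ Ico (j + 1) K, ∑ i ∈ range n, ρ (l + n - i) * (gB (l + n) - gB i) with hU1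
  set Γ : ℝ := ∑ i ∈ Ico j (K - 1), (gA i) ^ 3 / 2 * ∑ a ∈ Ico 1 (K - i), ρ a with hΓ
  set Ej : ℝ := ∑ i ∈ range n, ρ (j + n - i) * (gB (j + n) - gB i) with hEj
  set S0 : ℝ := ∑ i ∈ range j, ρ (j - i) * (gA i - gB (i + n)) with hS0
  set q : ℝ := (gA j) ^ 3 / 2 with hq
  have he : ∀ i, i ≤ K → 0 ≤ gA i - gB (i + n) := fun i hi => by
    linarith [le_of_one_div_sq_le (hApos i hi) (hBpos (i + n) (by omega)) (hdom i hi)]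
  have hEj0 : 0 ≤ Ej := by have := extra_nonneg hβ hb hρ0 hB hBpos (j := j) hj.le; simpa [hEj] using this
  have hS00 : 0 ≤ S0 := Finset.sum_nonneg fun i hi => mul_nonneg (hρ0 _) (he i (by have := Finset.mem_range.mp hi; omega))
  have hU10 : 0 ≤ U1 := Finset.sum_nonneg fun l hl =>
    extra_nonneg hβ hb hρ0 hB hBpos (j := l) (by have := (Finset.mem_Ico.mp hl).2; omega)
  have hRj0 : 0 ≤ Rj := Finset.sum_nonneg fun a _ => hρ0 a
  have hq0 : 0 ≤ q := div_nonneg (pow_nonneg (hApos j hj.le).le 3) (by norm_num)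
  -- the step identity at `j`: `d_j − d_{j+1} = E_j + S°_j − R_j·e_j`
  have hid : d j - d (j + 1) = Ej + S0 - Rj * (gA j - gB (j + n)) := by
    have h := disc_step_window hβ hb hρ0 hA hB hApos hBpos hj
    have hsplit : ∑ i ∈ range (j + 1), ρ (j - i) * ((gA i - gB (i + n)) - (gA j - gB (j + n)))
        = S0 - Rj * (gA j - gB (j + n)) := by
      rw [Finset.sum_range_succ, Nat.sub_self, sub_self, mul_zero, add_zero]
      have e1 : ∑ i ∈ range j, ρ (j - i) * ((gA i - gB (i + n)) - (gA j - gB (j + n)))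
          = S0 - (∑ i ∈ range j, ρ (j - i)) * (gA j - gB (j + n)) := by
        rw [hS0, Finset.sum_mul, ← Finset.sum_sub_distrib]
        exact Finset.sum_congr rfl fun i _ => by ring
      have e2 : ∑ i ∈ range j, ρ (j - i) = Rj := by
        rw [hRj, Finset.sum_Ico_eq_sum_range, show j + 1 - 1 = j by omega, ← Finset.sum_range_reflect _ j]
        refine Finset.sum_congr rfl fun i hi => ?_
        have hi' := Finset.mem_range.mp hi
        congr 1; omega
      rw [e1, e2]
    rw [hsplit] at h
    have h2 : d j - d (j + 1) = Ej + (S0 - Rj * (gA j - gB (j + n))) := by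
      simpa [hd, hEj, Nat.add_right_comm j 1 n] using h
    linarith [h2]
  -- case split: either already `d_{j+1} ≤ d_j`, or the future dominates from `j` on
  rcases le_or_gt (d (j + 1)) (d j) with hle | hlt
  · simpa [hd, Nat.add_right_comm j 1 n] using hle
  · exfalso
    -- monotone future from `j` on
    have hchain : ∀ t, j + 1 + t ≤ K → d (j + 1 + t) ≤ d (j + 1) := by
      intro t
      induction t with
      | zero => intro _; exact le_rfl
      | succ t ih =>
        intro ht
        have h1 := ih (by omega)
        have h2 := hfut (j + 1 + t) (by omega) (by omega)
        have h2' : d (j + 1 + t + 1) ≤ d (j + 1 + t) := by simpa [hd, Nat.add_right_comm (j + 1 + t) 1 n] using h2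
        rw [show j + 1 + (t + 1) = j + 1 + t + 1 by omega]
        exact h2'.trans h1
    have hfut' : ∀ i, j ≤ i → i ≤ K → d i ≤ d (j + 1) := by
      intro i hij hiK
      rcases Nat.lt_or_ge i (j + 1) with h | h
      · have : i = j := by omega
        subst this; exact hlt.le
      · have := hchain (i - (j + 1)) (by omega)
        rwa [show j + 1 + (i - (j + 1)) = i by omega] at this
    have hD := disc_succ_mul_le_of_monotone_future hβ hb hρ0 hmono hA hB hApos hBpos hpin hj
      (fun i hij hiK => by simpa [hd, Nat.add_right_comm j 1 n] using hfut' i hij hiK)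
    -- in the names: `d_{j+1}·(1 − Γ) ≤ U1 + (K−1−j)·S0`
    have hD' : d (j + 1) * (1 - Γ) ≤ U1 + ((K - 1 - j : ℕ) : ℝ) * S0 := by
      simpa [hd, hΓ, hU1, hS0, Nat.add_right_comm j 1 n] using hD
    -- `e_j ≤ q·d_j < q·d_{j+1}`
    have hej : gA j - gB (j + n) ≤ q * d j := by
      have := gap_le_cube_mul (hBpos (j + n) (by omega)) (le_of_one_div_sq_le (hApos j hj.le) (hBpos (j + n) (by omega)) (hdom j hj.le))
      simpa [hq, hd] using this
    -- ultraviolet suppression: `Rj·q·(K−1−j) ≤ Wγ∕(2b)` and `Rj ≤ W`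
    have hRjW : Rj ≤ W := by
      have : Rj ≤ ∑ a ∈ range (j + 1), ρ a := by
        rw [hRj, ← Finset.sum_range_add_sum_Ico _ (show 1 ≤ j + 1 by omega), Finset.sum_range_one]
        linarith [hρ0 0]
      exact this.trans (hρW _)
    have huv : (gA j) ^ 3 * ((K - j : ℕ) : ℝ) ≤ γ / b := cube_mul_dist_le hβ hb hρ0 hA hAbox hj.le
    have hW : 0 ≤ W := by simpa using hρW 0
    have hθ : Rj * q * ((K - 1 - j : ℕ) : ℝ) ≤ W * γ / (2 * b) := by
      have hKj : ((K - 1 - j : ℕ) : ℝ) ≤ ((K - j : ℕ) : ℝ) := by exact_mod_cast (show K - 1 - j ≤ K - j by omega)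
      have hg3 : 0 ≤ (gA j) ^ 3 := pow_nonneg (hApos j hj.le).le 3
      have h1 : (gA j) ^ 3 * ((K - 1 - j : ℕ) : ℝ) ≤ γ / b := (mul_le_mul_of_nonneg_left hKj hg3).trans huv
      calc Rj * q * ((K - 1 - j : ℕ) : ℝ) = Rj * ((gA j) ^ 3 * ((K - 1 - j : ℕ) : ℝ)) / 2 := by rw [hq]; ring
        _ ≤ W * (γ / b) / 2 := by
            have := mul_le_mul hRjW h1 (by positivity) hW
            linarith
        _ = W * γ / (2 * b) := by field_simp
    -- from the identity and `d_j < d_{j+1}`: `Rj·e_j > Ej + S0`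
    have hneg : Ej + S0 < Rj * (gA j - gB (j + n)) := by linarith [hid, hlt]
    -- `Rj·e_j ≤ Rj·q·d_{j+1}`
    have hRe : Rj * (gA j - gB (j + n)) ≤ Rj * q * d (j + 1) := by
      have := mul_le_mul_of_nonneg_left (hej.trans (mul_le_mul_of_nonneg_left hlt.le hq0)) hRj0
      linarith [this]
    have hΓ1 : 0 < 1 - Γ := by linarith [hΓ]
    have hD1 : d (j + 1) ≤ (U1 + ((K - 1 - j : ℕ) : ℝ) * S0) / (1 - Γ) := by
      rw [le_div_iff₀ hΓ1]; linarith [hD']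
    have hcrit' : Rj * q * U1 ≤ (1 - Γ) * Ej + (1 - Γ - W * γ / (2 * b)) * S0 := by simpa [hRj, hq, hU1, hΓ, hEj, hS0] using hcrit
    -- chain: Ej + S0 < Rj q d_{j+1} ≤ Rj q (U1 + (K−1−j) S0)/(1−Γ) ≤ [(1−Γ)Ej + (1−Γ−w∕2)S0 + (w∕2) S0]/(1−Γ) = Ej + S0: contradiction
    have h1 : Rj * q * d (j + 1) ≤ Rj * q * ((U1 + ((K - 1 - j : ℕ) : ℝ) * S0) / (1 - Γ)) :=
      mul_le_mul_of_nonneg_left hD1 (mul_nonneg hRj0 hq0)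
    have h2 : Rj * q * ((U1 + ((K - 1 - j : ℕ) : ℝ) * S0) / (1 - Γ))
        = (Rj * q * U1 + (Rj * q * ((K - 1 - j : ℕ) : ℝ)) * S0) / (1 - Γ) := by ring
    have h3 : Rj * q * U1 + (Rj * q * ((K - 1 - j : ℕ) : ℝ)) * S0 ≤ (1 - Γ) * (Ej + S0) := by
      have := mul_le_mul_of_nonneg_right hθ hS00
      nlinarith [hcrit', this]
    have h4 : (Rj * q * U1 + (Rj * q * ((K - 1 - j : ℕ) : ℝ)) * S0) / (1 - Γ) ≤ Ej + S0 := by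
      rw [div_le_iff₀ hΓ1]; linarith [h3]
    linarith [hneg, hRe, h1, h2.le, h2.ge, h4]

/-- **THE BACKWARD INDUCTION OVER THE LATE MEMORY ZONE.**  Road P3's order-0 profile family in ]0,γ] with a profile non-increasing on the positive
ages and memory `A` (`ρ(a) = 0` for `a > A`), `Σ_{a<N} ρ(a) ≤ W`, `Wγ ≤ 2b`; two pinned runs A: `K` ∕ B: `K + n`.  IF at every memory-zone position `j`
with `J < j < A` (and `j < K`) the future feedback is subcritical (`Γ_j < 1`) and the BACKWARD CRITERION of `disc_succ_le_disc_of_backward_criterion`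
holds, THEN `d_{j+1} ≤ d_j` at every `j` with `J < j < K` — downward induction from the pin: beyond the memory the first file's echo count
(`disc_succ_le_disc_of_memory_le`, unconditional), inside it the backward step fed by the already-monotone future. [cite: Balaban1987RG1, (0.20) p.256, (0.31) and Thm 2 p.259] -/
theorem disc_succ_le_disc_backward_zone
    (hβ : ∀ (k : ℕ) (p : Fin (k + 1) → ℝ),
      β k p = b + ∑ i : Fin (k + 1), ρ (k - i) * min (p (Fin.last k)) (|p (Fin.last k) - p i|))
    (hb : 0 < b) (hρ0 : ∀ a, 0 ≤ ρ a) (hρW : ∀ n, ∑ a ∈ range n, ρ a ≤ W) (hmono : ∀ a, 1 ≤ a → ρ (a + 1) ≤ ρ a)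
    (hWγ : W * γ ≤ 2 * b) {A : ℕ} (hρA : ∀ a, A < a → ρ a = 0) {K n : ℕ} {gA gB : ℕ → ℝ} (hA : RGEqH K β gA)
    (hB : RGEqH (K + n) β gB) (hAbox : ∀ k, k ≤ K → 0 < gA k ∧ gA k ≤ γ) (hBpos : ∀ k, k ≤ K + n → 0 < gB k)
    (hpin : gA K = gB (K + n)) {J : ℕ}
    (hΓ : ∀ j, J < j → j < A → j < K → ∑ i ∈ Ico j (K - 1), (gA i) ^ 3 / 2 * ∑ a ∈ Ico 1 (K - i), ρ a < 1)
    (hcrit : ∀ j, J < j → j < A → j < K →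
      (∑ a ∈ Ico 1 (j + 1), ρ a) * ((gA j) ^ 3 / 2)
          * (∑ l ∈ Ico (j + 1) K, ∑ i ∈ range n, ρ (l + n - i) * (gB (l + n) - gB i))
        ≤ (1 - ∑ i ∈ Ico j (K - 1), (gA i) ^ 3 / 2 * ∑ a ∈ Ico 1 (K - i), ρ a)
            * (∑ i ∈ range n, ρ (j + n - i) * (gB (j + n) - gB i))
          + (1 - (∑ i ∈ Ico j (K - 1), (gA i) ^ 3 / 2 * ∑ a ∈ Ico 1 (K - i), ρ a) - W * γ / (2 * b))
            * ∑ i ∈ range j, ρ (j - i) * (gA i - gB (i + n))) :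
    ∀ j, J < j → j < K → 1 / (gB (j + 1 + n)) ^ 2 - 1 / (gA (j + 1)) ^ 2 ≤ 1 / (gB (j + n)) ^ 2 - 1 / (gA j) ^ 2 := by
  -- downward induction on the distance `t = K − 1 − j` from the last step, carrying the whole monotone future
  suffices hmain : ∀ t, t < K → J < K - 1 - t →
      ∀ l, K - 1 - t ≤ l → l < K → 1 / (gB (l + 1 + n)) ^ 2 - 1 / (gA (l + 1)) ^ 2 ≤ 1 / (gB (l + n)) ^ 2 - 1 / (gA l) ^ 2 by
    intro j hJj hjK
    exact hmain (K - 1 - j) (by omega) (by omega) j (by omega) hjK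
  intro t
  induction t with
  | zero =>
    intro hK hJ l hl hlK
    have hl' : l = K - 1 := by omega
    subst hl'
    -- the last step: `d_K = 0 ≤ d_{K−1}`
    have hApos : ∀ k, k ≤ K → 0 < gA k := fun k hk => (hAbox k hk).1
    have hdom := invSq_le_invSq_shift_run hβ hb hρ0 hA hB hApos hBpos hpin
    rw [show K - 1 + 1 + n = K + n by omega, show K - 1 + 1 = K by omega, hpin, sub_self]
    linarith [hdom (K - 1) (by omega)]
  | succ t ih =>
    intro htK hJ l hl hlK
    rcases Nat.lt_or_ge (K - 1 - (t + 1)) l with hgt | hle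
    · exact ih (by omega) (by omega) l (by omega) hlK
    · have hleq : l = K - 1 - (t + 1) := by omega
      have ih' := ih (by omega) (by omega)
      rcases Nat.lt_or_ge l A with hlA | hlA
      · -- memory zone: the backward step, the future being monotone by the induction hypothesis
        refine disc_succ_le_disc_of_backward_criterion hβ hb hρ0 hρW hmono hA hB hAbox hBpos hpin hlK
          (fun m hm hmK => ih' m (by omega) hmK) (hΓ l (by omega) hlA hlK) (hcrit l (by omega) hlA hlK)
      · exact disc_succ_le_disc_of_memory_le hβ hb hρ0 hρW hmono hWγ hρA hA hB hAbox hBpos hpin hlA hlK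

/-- **THE MIXED SCHEME.**  Same setting.  IF `d` is already known to be non-increasing on `[0, J+1]` (e.g. by the forward induction of the third ∕
fifth files under their criterion on `[1, J]`) AND the backward criterion (with subcritical future feedback) holds at every memory-zone position
`J < j < A`, THEN `d_{j+1} ≤ d_j` at EVERY `j < K`.  The two inductions do not interact (forward uses only positions `< j ≤ J`, backward only
positions `> j > J`); seat numerics: with the crude provable forms of both criteria such a `J` exists in all 3 008 cases at `Wγ ≤ b∕2`
(`HOME/b2b-balaban-beta-d4-p3/g54/numerics/mixed2.py`). [cite: Balaban1987RG1, (0.20) p.256, (0.31) and Thm 2 p.259] -/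
theorem disc_succ_le_disc_mixed
    (hβ : ∀ (k : ℕ) (p : Fin (k + 1) → ℝ),
      β k p = b + ∑ i : Fin (k + 1), ρ (k - i) * min (p (Fin.last k)) (|p (Fin.last k) - p i|))
    (hb : 0 < b) (hρ0 : ∀ a, 0 ≤ ρ a) (hρW : ∀ n, ∑ a ∈ range n, ρ a ≤ W) (hmono : ∀ a, 1 ≤ a → ρ (a + 1) ≤ ρ a)
    (hWγ : W * γ ≤ 2 * b) {A : ℕ} (hρA : ∀ a, A < a → ρ a = 0) {K n : ℕ} {gA gB : ℕ → ℝ} (hA : RGEqH K β gA)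
    (hB : RGEqH (K + n) β gB) (hAbox : ∀ k, k ≤ K → 0 < gA k ∧ gA k ≤ γ) (hBpos : ∀ k, k ≤ K + n → 0 < gB k)
    (hpin : gA K = gB (K + n)) {J : ℕ}
    (hfwd : ∀ j, j ≤ J → j < K → 1 / (gB (j + 1 + n)) ^ 2 - 1 / (gA (j + 1)) ^ 2 ≤ 1 / (gB (j + n)) ^ 2 - 1 / (gA j) ^ 2)
    (hΓ : ∀ j, J < j → j < A → j < K → ∑ i ∈ Ico j (K - 1), (gA i) ^ 3 / 2 * ∑ a ∈ Ico 1 (K - i), ρ a < 1)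
    (hcrit : ∀ j, J < j → j < A → j < K →
      (∑ a ∈ Ico 1 (j + 1), ρ a) * ((gA j) ^ 3 / 2)
          * (∑ l ∈ Ico (j + 1) K, ∑ i ∈ range n, ρ (l + n - i) * (gB (l + n) - gB i))
        ≤ (1 - ∑ i ∈ Ico j (K - 1), (gA i) ^ 3 / 2 * ∑ a ∈ Ico 1 (K - i), ρ a)
            * (∑ i ∈ range n, ρ (j + n - i) * (gB (j + n) - gB i))
          + (1 - (∑ i ∈ Ico j (K - 1), (gA i) ^ 3 / 2 * ∑ a ∈ Ico 1 (K - i), ρ a) - W * γ / (2 * b))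
            * ∑ i ∈ range j, ρ (j - i) * (gA i - gB (i + n))) :
    ∀ j, j < K → 1 / (gB (j + 1 + n)) ^ 2 - 1 / (gA (j + 1)) ^ 2 ≤ 1 / (gB (j + n)) ^ 2 - 1 / (gA j) ^ 2 := by
  intro j hj
  rcases Nat.lt_or_ge J j with hJj | hJj
  · exact disc_succ_le_disc_backward_zone hβ hb hρ0 hρW hmono hWγ hρA hA hB hAbox hBpos hpin hΓ hcrit j hJj hj
  · exact hfwd j hJj hj

end Summit.QuantumFields.BalabanUV.Beta.RemainderExplicitHistoryDiagonalMemoryZoneBackward
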